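import Literature.Computability.Complexity.EasyWitnessUniversalProofs
import Literature.Computability.Complexity.IKWGeneratorsProofs
import HarnessLib

/-!
# `NEXP ⊆ P/poly ⟹ NEXP = EXP` — discharge of the named fact (Impagliazzo–Kabanets–Wigderson 2002, Thm. 24; Arora–Barak 2009, Lemma 20.20)

`NEXP_eq_EXP_of_subset_PPoly` (`ExpTimeCollapses.lean`) is IKW's Theorem 24 (= Arora–Barak Lemma 20.20,
p. 417: "if NEXP ⊆ P/poly then … NEXP = EXP", proved there by contradiction from EXP = MA under
EXP ⊆ P/poly and the easy-witness derandomization of MA). Its proof in the tree follows the printed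
architecture of IKW §4.1: `NEXP_eq_EXP_of_subset_PPoly_of_thm12_2` (`EasyWitnessUniversalProofs.lean`:
Thm. 24 assembled from Thm. 22 = `EXP_eq_MA_of_subset_PPoly_holds` (`EasyWitnessProofs.lean`, via Meyer's
theorem and the sumcheck protocol), Lemma 17 / Thm. 18 in the `MA` case (`EasyWitnessGenerator.lean`,
`EasyWitnessSearch.lean`), Lemma 5 (`EasyWitnessUniversal*.lean`, `NTIMEWindow.lean`,
`UniversalNEXP*.lean`), Thm. 2 (`KannanLanguageAE.lean`, `EasyWitnessProofs.lean`) and Cor. 8 — all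
proved) applied to `IKW2002_thm12_2_holds` (`IKWGeneratorsProofs.lean`: IKW Thm. 12 (2), the
Goldreich–Zuckerman nondeterministic simulation of `MA` armed with the generator of IKW Thm. 11).
This file only holds the resulting one-line discharge; it is a separate module because
`ExpTimeCollapses.lean` (the def) is imported by all of the above.

## References
* R. Impagliazzo, V. Kabanets, A. Wigderson, JCSS 65 (2002) 672–694, Thm. 24 [ImpagliazzoKabanetsWigderson2002].
* S. Arora, B. Barak, *Computational Complexity: A Modern Approach*, CUP 2009, Lemma 20.20, p. 417 [AroraBarakCC2009].
-/

namespace Literature.Computability.Complexity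

/-- **IKW Theorem 24 / Arora–Barak Lemma 20.20**: `NEXP ⊆ P/poly ⟹ NEXP = EXP`, discharged.
[cite: ImpagliazzoKabanetsWigderson2002, Thm. 24] [cite: AroraBarakCC2009, Lemma 20.20] -/
theorem NEXP_eq_EXP_of_subset_PPoly_holds : NEXP_eq_EXP_of_subset_PPoly :=
  NEXP_eq_EXP_of_subset_PPoly_of_thm12_2 IKW2002_thm12_2_holds

end Literature.Computability.Complexity
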